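import Summits.BirchSwinnertonDyer.BirchSwinnertonDyer.Theorems.ByReductionTypeAtTwoGoodOrdTowerEPTower
import Literature.NumberTheory.GaloisRepresentations.LocalDualityDescent
import Mathlib.GroupTheory.SpecificGroups.Cyclic
import HarnessLib

/-!
# Route `ByReductionTypeAtTwo`, item `OrdKatoHalfAtTwo` (stmt-BirchSwinnertonDyer-19271), TOWER road, the
# GOOD-ORDINARY local tower kernels at `v ∣ 2` at FULL `2`-power depth: BRICK C′ — the Euler–Poincaré count of ANY
# order-`2` module over the layer group `H_n` (transport of BRICK G5's `μ₂` count)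

HONEST FRAMING (cell `bsd-2adic`, run/shared/lean/pub/bsd-2adic/, seat `bsd-2adic-tower-1` GEN 20, HUMAN RULINGS
D-0036 / D-0054 / D-0074): TOOL theorem only (no definition, no named fact, no `sorry`); closes nothing by itself;
nothing booked; BSD is not proved by any of this. The base case fed to BRICK C (`…GoodOrdTowerControlEuler.lean`,
dévissage of a cyclic `2`-power module from its order-`2` constituents) in the programme «UNIFORM layer bound at a good
ordinary `2`» ⇒ `WeierstrassCurve.Greenberg1999_kerG_bounded` / Mazur's control theorem `WeierstrassCurve.selmer_control`
over `ℚ` at `p = 2`: GEN 11's BRICK G5 (`natCard_cohomology_mu_two_layer`: `#H¹(H_n, μ₂) = 2^{2^n+2}`, `#H²(H_n, μ₂) = 2`)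
transported to every discrete `H_n`-module `V` of order `2` (any such `V` has trivial action and is isomorphic to `μ₂|_{H_n}`,
`−1 ∈ ℚ₂`).

* `layer_euler_count_of_card_two` — for `κ` the cyclotomic `ℤ₂`-extension, `v ∣ 2`, `H_n` the local layer group and any
  discrete `H_n`-module `V` with `#V = 2`: `H¹(H_n, V)`, `H²(H_n, V)` are finite and
  `#H¹(H_n, V) = 2^{2^n} · #V^{H_n} · #H²(H_n, V)` (`= 2^{2^n} · 2 · 2`).

References: J.-P. Serre, *Galois Cohomology* (1997), II §5.7; J. Milne, *ADT* (2006), I Thm. 2.8.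
-/

set_option autoImplicit false
-- the Theorems namespace of this sub repeats the summit name by design (D-0017 nested layout: Summit.<S>.<Sub>)
set_option linter.dupNamespace false

noncomputable section

open scoped Classical

namespace Summit.BirchSwinnertonDyer.BirchSwinnertonDyer.Theorems.GoodOrdTower

open CategoryTheory NumberField IsDedekindDomain Field
  Literature.NumberTheory.GaloisRepresentations Literature.NumberTheory.GaloisRepresentations.DiscreteGaloisModule
  _root_.TopRep _root_.ContRepresentation _root_.ContinuousCohomology
open Literature.NumberTheory.EllipticCurves hiding subgroupIncl

variable {κ : ZpExtension ℚ 2}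

set_option maxHeartbeats 800000 in
/-- **The Euler–Poincaré count of an order-`2` module over the layer group `H_n`**: for the cyclotomic `ℤ₂`-extension
`κ`, `v ∣ 2`, the local layer group `H_n = localSubgroup (κ.layerSubgroup n) ℚ_v` and ANY discrete `H_n`-module `V` with
two elements, `H¹(H_n, V)` and `H²(H_n, V)` are finite and `#H¹(H_n, V) = 2^{2^n} · #V^{H_n} · #H²(H_n, V)`. Proof: `V` has
trivial action and is isomorphic to `μ₂` restricted to `H_n` (`−1 ∈ ℚ_v`); transport BRICK G5's counts
`#H¹(H_n, μ₂) = 2^{2^n+2}`, `#H²(H_n, μ₂) = 2` along the isomorphism (`ContinuousCohomologyTransport`).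
[cite: SerreGaloisCohomology1997, II §5.7 Thm. 5] [cite: MilneADT2006, I §2 Thm. 2.8] -/
theorem layer_euler_count_of_card_two (hκ : κ.IsCyclotomic) (v : HeightOneSpectrum (𝓞 ℚ))
    (hv : ((2 : ℕ) : 𝓞 ℚ) ∈ v.asIdeal) (n : ℕ)
    (V : Type) [AddCommGroup V] [TopologicalSpace V] [DiscreteTopology V] [Finite V]
    (τ : ContinuousRep (localSubgroup (κ.layerSubgroup n) (v.adicCompletion ℚ)) ℤ V) (hV : Nat.card V = 2) :
    Finite (continuousCohomology 1 τ.toTopRep) ∧ Finite (continuousCohomology 2 τ.toTopRep) ∧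
      Nat.card (continuousCohomology 1 τ.toTopRep) =
        2 ^ 2 ^ n * Nat.card τ.toTopRep.ρ.invariants * Nat.card (continuousCohomology 2 τ.toTopRep) := by
  let K := v.adicCompletion ℚ
  let Hn : Subgroup (absoluteGaloisGroup K) := localSubgroup (κ.layerSubgroup n) K
  haveI : Fact (Nat.Prime 2) := ⟨Nat.prime_two⟩
  -- `V` has trivial action: the non-zero element is unique
  obtain ⟨x₀, y₀, hxy, huniv⟩ := Nat.card_eq_two_iff.mp hV
  have hV2 : ∀ a b : V, a ≠ 0 → b ≠ 0 → a = b := by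
    intro a b ha hb
    have hmem : ∀ c : V, c = x₀ ∨ c = y₀ := fun c ↦ by
      have hc : c ∈ ({x₀, y₀} : Set V) := by rw [huniv]; exact Set.mem_univ c
      simpa using hc
    rcases hmem 0 with h0 | h0 <;> rcases hmem a with h1 | h1 <;> rcases hmem b with h2 | h2
    all_goals first
      | (exact h1.trans h2.symm)
      | (exfalso; exact ha (h1.trans h0.symm))
      | (exfalso; exact hb (h2.trans h0.symm))
  have hinjτ : ∀ (g : Hn) (a : V), τ g a = 0 → a = 0 := fun g a h ↦ by
    have h' := congrArg (τ g⁻¹) h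
    rwa [← Module.End.mul_apply, ← map_mul, inv_mul_cancel, map_one, Module.End.one_apply, map_zero] at h'
  have hfix : ∀ (g : Hn) (a : V), τ g a = a := fun g a ↦ by
    by_cases ha : a = 0
    · rw [ha, map_zero]
    · exact hV2 _ _ (fun h ↦ ha (hinjτ g a h)) ha
  -- `μ₂` has trivial action (`−1 ∈ ℚ_v`)
  have hζ : IsPrimitiveRoot (-1 : K) 2 := by
    haveI : CharZero K := charZero_of_injective_algebraMap (algebraMap ℚ K).injective
    exact IsPrimitiveRoot.neg_one 0 (by norm_num)
  have htrivμ : ∀ (σ : absoluteGaloisGroup K) (z : MuCarrier K 2), mu K 2 σ z = z :=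
    mu_apply_eq_self_of_isPrimitiveRoot K hζ
  -- an additive isomorphism `V ≃+ μ₂`
  have eμ : MuCarrier K 2 ≃+ ZMod 2 := by
    haveI : CharZero K := charZero_of_injective_algebraMap (algebraMap ℚ K).injective
    exact muEquivZMod K 2
  have eV : ZMod 2 ≃+ V := by
    haveI : Fact (Nat.card V).Prime := ⟨by rw [hV]; exact Nat.prime_two⟩
    have hcyc : IsAddCyclic V := isAddCyclic_of_prime_card (p := Nat.card V) rfl
    have e := zmodAddCyclicAddEquiv hcyc
    rw [hV] at e
    exact e
  let f : V ≃+ MuCarrier K 2 := eV.symm.trans eμ.symm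
  -- the two `H_n`-representations and the transport data
  let X : TopRep ℤ Hn := τ.toTopRep
  let Y : TopRep ℤ Hn := ((mu K 2).restrict (subgroupIncl Hn)).toTopRep
  let e : Hn ≃ₜ* Hn := ContinuousMulEquiv.refl Hn
  let φ : TopRep.res ((e.symm : Hn →ₜ* Hn) : Hn →* Hn) X ⟶ Y :=
    TopRep.ofHom
      { toLinearMap := (f : V →+ MuCarrier K 2).toIntLinearMap
        cont := continuous_of_discreteTopology
        isIntertwining' := fun g ↦ by
          ext a
          change f (τ (e.symm g) a) = mu K 2 ((g : Hn) : absoluteGaloisGroup K) (f a)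
          rw [hfix, htrivμ] }
  let ψ : TopRep.res ((e : Hn →ₜ* Hn) : Hn →* Hn) Y ⟶ X :=
    TopRep.ofHom
      { toLinearMap := (f.symm : MuCarrier K 2 →+ V).toIntLinearMap
        cont := continuous_of_discreteTopology
        isIntertwining' := fun g ↦ by
          ext z
          change f.symm (mu K 2 (((e g) : Hn) : absoluteGaloisGroup K) z) = τ g (f.symm z)
          rw [hfix, htrivμ] }
  have hψφ : ∀ a : X, ψ.hom (φ.hom a) = a := fun a ↦ f.symm_apply_apply a
  have hφψ : ∀ z : Y, φ.hom (ψ.hom z) = z := fun z ↦ f.apply_symm_apply z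
  -- BRICK G5
  obtain ⟨hfin1, hfin2, hcard1, hcard2⟩ := natCard_cohomology_mu_two_layer hκ v hv n
  haveI := hfin1
  haveI := hfin2
  have h1 := natCard_continuousCohomology_eq_of_continuousMulEquiv e φ ψ hψφ hφψ 1
  have h2 := natCard_continuousCohomology_eq_of_continuousMulEquiv e φ ψ hψφ hφψ 2
  have hf1 : Finite (continuousCohomology 1 X) := finite_continuousCohomology_of_continuousMulEquiv e φ ψ hψφ 1
  have hf2 : Finite (continuousCohomology 2 X) := finite_continuousCohomology_of_continuousMulEquiv e φ ψ hψφ 2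
  -- invariants: all of `V`
  have hinv : Nat.card τ.toTopRep.ρ.invariants = 2 := by
    have h : Nat.card τ.toTopRep.ρ.invariants = Nat.card V := Nat.card_congr
      { toFun := fun w ↦ w.1
        invFun := fun a ↦ ⟨a, fun g ↦ hfix g a⟩
        left_inv := fun _ ↦ rfl
        right_inv := fun _ ↦ rfl }
    exact h.trans hV
  refine ⟨hf1, hf2, ?_⟩
  change Nat.card (continuousCohomology 1 X) = 2 ^ 2 ^ n * Nat.card τ.toTopRep.ρ.invariants * Nat.card (continuousCohomology 2 X)
  rw [h1, h2, hcard1, hcard2, hinv, pow_add]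
  ring

end Summit.BirchSwinnertonDyer.BirchSwinnertonDyer.Theorems.GoodOrdTower

end
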